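import Literature.MathematicalPhysics.QuantumLattice.GibbsKMSMomentRow
import Literature.MathematicalPhysics.QuantumLattice.InfVolFermionStateTorusLimitBogoliubovRow
import HarnessLib

/-!
# Thermal torus-limit states of the `t–t'` Hubbard model satisfy the KMS-moment rows

Topic `Literature/MathematicalPhysics/QuantumLattice`; the KMS-moment twin of
`InfVolFermionStateTorusLimitBogoliubovRow.lean` (Bogoliubov rows) and
`InfVolFermionStateTorusLimitEnergyEntropyBalance.lean` (linearised EEB rows). The finite-volume
states are the canonical GIBBS states `ρ_{L,β} ∝ P_K e^{−βH_L}` of the `t–t'` Hubbard torus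
`H_L = hubbardTorusTT' L t t' U` on the sector `K = (rectN n L, S^z = 0)` (eigen-mixtures
`sectorGibbsWeightTT'`, `sectorGibbsVectorTT'`), and `ω` is any torus limit of their translation
averages along `Ls → ∞` (`InfVolFermionState.IsTorusLimitOfMixture`). We prove that `ω` satisfies, for
every finite region `Λ`, every window `Λ' ⊇ Λ` containing the `K`-th king-move neighbourhood
`((· )₁)^K Λ` of `Λ` (`(fun S => thicken S 1)^[K] Λ ⊆ Λ'`), `H_{Λ'}` the free-boundary local Hamiltonian
of `hubbardTTPrimeFermionInteraction t t' U`, every local `A ∈ 𝔄_Λ` conserving the local particle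
number and `S^z` (`Ã = Γ_{Λ⊆Λ'}A`), every real `β` and all coefficients `p q : ℕ → ℝ` whose exponential
polynomial `P(x) = Σ_{k≤K}(pₖ + qₖe^{-βx})x^k` is nonnegative on `ℝ`, the **KMS-moment row**

  `0 ≤ Σ_{k≤K} ( pₖ · Re ω_{Λ'}(Ãᴴ ad_{H_{Λ'}}^k Ã) + qₖ · Re ω_{Λ'}((ad_{H_{Λ'}}^k Ã) Ãᴴ) )`,
  `ad_H X = HX − XH`

(`IsTorusLimitOfMixture.sum_range_kmsMoment_nonneg_of_sectorGibbs`) — the positivity of the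
exponential-polynomial test function against the spectral measure of the word `Ã` in a `β`-KMS state
(Itoi–Ishimori–Sato–Sakamoto [ItoiEtAl2023] §3: the fixed-`P` members are their Thms 1–4; the
degree-`(1,0)` members `P(x) = s + (1 − βs + βs·log(βs)·…)`-free tangent lines of `x ↦ x` vs. `e^{-βx}`
are the linearised energy–entropy-balance rows of Fawzi–Fawzi–Scalet [FawziFawziScalet2024] Thm 3.1),
here for the gauge-invariant words of a canonical limit. Read over a template family this is an exact
KMS constraint LINEAR in the moments of `ω` (hubbard-thermal THERMAL-SOURCES §2k, row family
`kmsmom`). Ingredients: the finite-volume rows for the translated canonical mixtures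
(`sum_range_kmsMoment_sectorGibbsTT'_fockTranslate_nonneg`, `GibbsKMSMomentRow.lean`), ITERATED
LOCALITY `Γ(ad_{H_{Λ'}}^k Ã) = ad_{H_L}^k (ΓÃ)` on the torus for `k ≤ K`
(`fermionEmbed_toTorusEmb_adPow_localHamiltonian`, §1, from the one-step locality
`hubbardTorusTT'_commutator_fermionEmbed` / `hubbardTTPrime_localHamiltonian_commutator_fermionEmbed_eq`),
the translation average (§2) and the limit (§3). Everything is PROVED; no definition, no named fact.

## Mathlib / tree search

REUSED: `Matrix.adPow`, `Matrix.IsHermitian.kmsMomentRow_nonneg` (`SpectralCorrelationInequalities`);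
`sum_range_kmsMoment_sectorGibbsTT'_fockTranslate_nonneg` (`GibbsKMSMomentRow`);
`hubbardTorusTT'_commutator_fermionEmbed` (`HubbardNNNHoppingLocalHamiltonian`),
`hubbardTTPrime_localHamiltonian_commutator_fermionEmbed_eq` (`HubbardTTPrimeWindowCertificateAbstractState`),
`commute_fermionEmbed_toTorusEmb_totalNumber/spinZ`, `torusAvgExpectAt_of_injOn`, `torusAvgExpect_eq`,
`eventually_injOn_proj_of_tendsto`, `fermionEmbed_fermionEmbed/congr/mul/conjTranspose`
(`InfVolFermionState`), `subset_thicken` (`InfiniteVolumeStates`). The monotonicity of iterated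
neighbourhoods is `thicken_iterate_mono` of `QuasiLocalAlgebraExistsDynamicsProofs` (C⋆-dynamics file,
not imported here; re-proved privately in five lines).

## References

* C. Itoi, H. Ishimori, K. Sato, Y. Sakamoto, J. Phys. Soc. Jpn. 92 (2023) 074001 = arXiv:2306.03489,
  §3 Lemmas 1–5 and the proofs of Thms 1–4 (spectral representation of `β`-KMS correlation
  inequalities). [cite: ItoiEtAl2023, §3]
* H. Fawzi, O. Fawzi, S. O. Scalet, Nat. Commun. 15 (2024) 7394 = arXiv:2311.18706, Thm 3.1.
  [cite: FawziFawziScalet2024, Thm 3.1]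
* O. Bratteli, D. W. Robinson, Operator Algebras and Quantum Statistical Mechanics II, 2nd ed. (1997),
  Thm. 6.2.4 and its proof (iterated commutators with local Hamiltonians, `δ^n(A) ∈ 𝔄_{Λ_n}`).
  [cite: BratteliRobinsonII1997, Thm. 6.2.4]
-/

noncomputable section

namespace Literature.MathematicalPhysics.QuantumLattice

open Matrix Finset HubbardWave0 Literature.Probability.LatticeModels ThermodynamicLimit
open _root_.Filter
open scoped _root_.Topology ComplexOrder BigOperators

/-! ### §1 Iterated locality: `Γ(ad_{H_{Λ'}}^k Ã) = ad_{H_L}^k (ΓÃ)` on the torus -/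

section IteratedLocality

/-- `ad^{k+1} = ad^k ∘ ad`. [folklore] -/
private theorem adPow_succ' {m : Type*} [Fintype m] (H a : Matrix m m ℂ) (k : ℕ) :
    adPow H (k + 1) a = adPow H k (H * a - a * H) := by
  induction k with
  | zero => simp
  | succ k ih => rw [adPow_succ, ih, ← adPow_succ]

/-- The iterated `R`-neighbourhoods `Λ ⊆ Λ_R ⊆ (Λ_R)_R ⊆ ⋯` increase (Bratteli–Robinson II §6.2.1;
`thicken_iterate_mono` of the C⋆-dynamics file, re-proved to keep the imports light). [folklore] -/
private theorem thicken_iterate_mono_kms {d : ℕ} (Λ : Finset (Site d)) (R : ℝ) {k n : ℕ} (h : k ≤ n) :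
    (fun S => thicken S R)^[k] Λ ⊆ (fun S => thicken S R)^[n] Λ := by
  induction n, h using Nat.le_induction with
  | base => exact subset_rfl
  | succ n _ ih =>
    refine ih.trans ?_
    rw [Function.iterate_succ_apply']
    exact subset_thicken _ R

variable (L : ℕ) [NeZero L] (t t' U : ℝ)

/-- **Iterated locality of the commutator with the `t–t'` torus Hamiltonian.** For a window `Λ'` with
`x ↦ x mod L` injective on `thicken Λ' 1`, a region `Λ ⊆ Λ'` whose `k`-th king-move neighbourhood
`((·)₁)^k Λ` is still inside `Λ'`, and `A ∈ 𝔄_Λ` (`Ã = Γ_{Λ⊆Λ'}A`, `Γ` the pull-back of `𝔄_{Λ'}` into the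
torus): `Γ(ad_{H^{tt'}_{Λ'}}^k Ã) = ad_{H^{tt'}_L}^k (Γ Ã)` — the `k`-fold form of
`[H_L, ΓÃ] = Γ[H_{Λ'}, Ã]` (`hubbardTorusTT'_commutator_fermionEmbed`), by induction through
`ad^{k+1} = ad^k ∘ ad` and the support growth `[H_{Λ'}, Γ_{Λ⊆Λ'}A] = Γ_{Λ₁⊆Λ'}[H_{Λ₁}, Γ_{Λ⊆Λ₁}A]`,
`Λ₁ = thicken Λ 1` (`hubbardTTPrime_localHamiltonian_commutator_fermionEmbed_eq`); Bratteli–Robinson II,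
proof of Thm. 6.2.4 (`δ^n(A) = i^n[H_{Λ'},[…[H_{Λ'}, A]]]` for `Λ' ⊇ Λ_n`).
[cite: BratteliRobinsonII1997, Thm. 6.2.4] -/
theorem fermionEmbed_toTorusEmb_adPow_localHamiltonian {Λ' : Finset (Site 2)}
    (hInj : Set.InjOn (Torus.proj (d := 2) L) ↑(thicken Λ' 1)) (k : ℕ) :
    ∀ {Λ : Finset (Site 2)} (hΛ : Λ ⊆ Λ') (_ : (fun S => thicken S 1)^[k] Λ ⊆ Λ') (A : FermionOp Λ),
      fermionEmbed (PolySite.toTorusEmb L (hInj.mono (by exact_mod_cast subset_thicken Λ' 1)))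
          (adPow ((hubbardTTPrimeFermionInteraction t t' U).localHamiltonian Λ') k
            (fermionEmbed (PolySite.incl hΛ) A)) =
        adPow (hubbardTorusTT' L t t' U) k
          (fermionEmbed (PolySite.toTorusEmb L (hInj.mono (by exact_mod_cast subset_thicken Λ' 1)))
            (fermionEmbed (PolySite.incl hΛ) A)) := by
  induction k with
  | zero =>
    intro Λ hΛ _ A
    rfl
  | succ k ih =>
    intro Λ hΛ hk A
    have h1 : thicken Λ 1 ⊆ Λ' :=
      (thicken_iterate_mono_kms Λ 1 (Nat.succ_le_succ (Nat.zero_le k))).trans hk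
    rw [adPow_succ', adPow_succ', hubbardTorusTT'_commutator_fermionEmbed L t t' U hΛ h1 hInj A,
      hubbardTTPrime_localHamiltonian_commutator_fermionEmbed_eq t t' U hΛ h1 A]
    exact ih h1 hk _

end IteratedLocality

/-! ### §2 Translation averages of the embedded local KMS-moment rows on the torus -/

section TorusAverage

variable (L : ℕ) [NeZero L] (t t' U : ℝ)

/-- **The KMS-moment rows of a local word, averaged over the torus translations, in the canonical Gibbs
mixture.** For a window `Λ'` with `x ↦ x mod L` injective on `thicken Λ' 1`, `Λ ⊆ Λ'` with
`((·)₁)^K Λ ⊆ Λ'`, a local `A ∈ 𝔄_Λ` conserving the local `N` and `S^z` (`Ã = Γ_{Λ⊆Λ'}A`), `H_{Λ'}` the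
free-boundary `t–t'–U` Hamiltonian of `Λ'`, every real `β` and coefficients `p q` with
`Σ_{k≤K}(pₖ + qₖe^{-βx})x^k ≥ 0` on `ℝ`:
`0 ≤ Σ_{k≤K} ( pₖ Re Σ_i p_{L,i} · torusAvgExpectAt L Λ' (Ãᴴ ad_{H_{Λ'}}^k Ã) ψ_{L,i} + qₖ Re Σ_i p_{L,i} · torusAvgExpectAt L Λ' ((ad_{H_{Λ'}}^k Ã)Ãᴴ) ψ_{L,i} )`
(iterated locality `Γ(ad_{H_{Λ'}}^k Ã) = ad_{H_L}^k (ΓÃ)` for `k ≤ K`; `ΓÃ` conserves the torus `N`, `S^z`;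
then the translated-mixture rows for every `v`). [cite: ItoiEtAl2023, §3] -/
theorem re_sum_range_kmsMoment_torusAvgExpectAt_nonneg (n β : ℝ) {Λ Λ' : Finset (Site 2)} (hΛ : Λ ⊆ Λ')
    {K : ℕ} (hK : (fun S => thicken S 1)^[K] Λ ⊆ Λ')
    (hInj : Set.InjOn (Torus.proj (d := 2) L) ↑(thicken Λ' 1))
    {A : FermionOp Λ} (hAN : Commute A totalNumber) (hAS : Commute A HubbardWave0.spinZ)
    (cp cq : ℕ → ℝ)
    (hP : ∀ x : ℝ, 0 ≤ ∑ k ∈ Finset.range (K + 1), (cp k + cq k * Real.exp (-(β * x))) * x ^ k) :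
    0 ≤ ∑ k ∈ Finset.range (K + 1),
      (cp k * (∑ i, (sectorGibbsWeightTT' β t t' U n L i : ℂ) *
          torusAvgExpectAt L Λ'
            ((fermionEmbed (PolySite.incl hΛ) A)ᴴ *
              adPow ((hubbardTTPrimeFermionInteraction t t' U).localHamiltonian Λ') k
                (fermionEmbed (PolySite.incl hΛ) A))
            (sectorGibbsVectorTT' t t' U n L i)).re +
        cq k * (∑ i, (sectorGibbsWeightTT' β t t' U n L i : ℂ) *
          torusAvgExpectAt L Λ'
            (adPow ((hubbardTTPrimeFermionInteraction t t' U).localHamiltonian Λ') k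
                (fermionEmbed (PolySite.incl hΛ) A) * (fermionEmbed (PolySite.incl hΛ) A)ᴴ)
            (sectorGibbsVectorTT' t t' U n L i)).re) := by
  have h₁ : Set.InjOn (Torus.proj (d := 2) L) ↑Λ' :=
    hInj.mono (by exact_mod_cast subset_thicken Λ' 1)
  have hΛT : Set.InjOn (Torus.proj (d := 2) L) ↑Λ := h₁.mono (by exact_mod_cast hΛ)
  -- the embedded word, as an embedding of `Λ` itself, and its conservation laws on the torus
  set B := fermionEmbed (PolySite.toTorusEmb L hΛT) A with hBdef
  have hB : fermionEmbed (PolySite.toTorusEmb L h₁) (fermionEmbed (PolySite.incl hΛ) A) = B := by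
    rw [hBdef, fermionEmbed_fermionEmbed]
    exact congrFun (congrArg DFunLike.coe (fermionEmbed_congr fun p => rfl)) A
  have hBN : Commute B totalNumber := commute_fermionEmbed_toTorusEmb_totalNumber L hΛT hAN
  have hBS : Commute B HubbardWave0.spinZ := commute_fermionEmbed_toTorusEmb_spinZ L hΛT hAS
  -- iterated locality: the pulled-back `ad^k` words are the torus `ad^k` words for `k ≤ K`
  have had : ∀ k ∈ Finset.range (K + 1), fermionEmbed (PolySite.toTorusEmb L h₁)
      (adPow ((hubbardTTPrimeFermionInteraction t t' U).localHamiltonian Λ') k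
        (fermionEmbed (PolySite.incl hΛ) A)) = adPow (hubbardTorusTT' L t t' U) k B := by
    intro k hk
    rw [fermionEmbed_toTorusEmb_adPow_localHamiltonian L t t' U hInj k hΛ
      ((thicken_iterate_mono_kms Λ 1 (Nat.lt_succ_iff.1 (Finset.mem_range.1 hk))).trans hK) A, hB]
  have hΓ1 : ∀ k ∈ Finset.range (K + 1), fermionEmbed (PolySite.toTorusEmb L h₁)
      ((fermionEmbed (PolySite.incl hΛ) A)ᴴ *
        adPow ((hubbardTTPrimeFermionInteraction t t' U).localHamiltonian Λ') k
          (fermionEmbed (PolySite.incl hΛ) A)) = Bᴴ * adPow (hubbardTorusTT' L t t' U) k B := by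
    intro k hk
    rw [fermionEmbed_mul, fermionEmbed_conjTranspose, had k hk, hB]
  have hΓ2 : ∀ k ∈ Finset.range (K + 1), fermionEmbed (PolySite.toTorusEmb L h₁)
      (adPow ((hubbardTTPrimeFermionInteraction t t' U).localHamiltonian Λ') k
          (fermionEmbed (PolySite.incl hΛ) A) * (fermionEmbed (PolySite.incl hΛ) A)ᴴ) =
      adPow (hubbardTorusTT' L t t' U) k B * Bᴴ := by
    intro k hk
    rw [fermionEmbed_mul, fermionEmbed_conjTranspose, had k hk, hB]
  -- each translate satisfies the rows
  have hv : ∀ v : TorusSite 2 L, 0 ≤ ∑ k ∈ Finset.range (K + 1),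
      (cp k * ∑ i, sectorGibbsWeightTT' β t t' U n L i *
          (expect (Bᴴ * adPow (hubbardTorusTT' L t t' U) k B)
            ((fockTranslate v).val *ᵥ sectorGibbsVectorTT' t t' U n L i)).re +
        cq k * ∑ i, sectorGibbsWeightTT' β t t' U n L i *
          (expect (adPow (hubbardTorusTT' L t t' U) k B * Bᴴ)
            ((fockTranslate v).val *ᵥ sectorGibbsVectorTT' t t' U n L i)).re) := fun v =>
    sum_range_kmsMoment_sectorGibbsTT'_fockTranslate_nonneg L t t' U n β v hBN hBS K cp cq hP
  -- bookkeeping: real part of the weighted translation average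
  have hcast : ((Fintype.card (TorusSite 2 L) : ℂ))⁻¹ =
      (((Fintype.card (TorusSite 2 L) : ℝ)⁻¹ : ℝ) : ℂ) := by
    push_cast; rfl
  have hre : ∀ X : Matrix (Finset (Orb (FermionTorus 2 L))) (Finset (Orb (FermionTorus 2 L))) ℂ,
      (∑ i, (sectorGibbsWeightTT' β t t' U n L i : ℂ) *
        (((Fintype.card (TorusSite 2 L) : ℂ))⁻¹ *
          ∑ v : TorusSite 2 L, expect X ((fockTranslate v).val *ᵥ sectorGibbsVectorTT' t t' U n L i))).re =
      (Fintype.card (TorusSite 2 L) : ℝ)⁻¹ * ∑ v : TorusSite 2 L, ∑ i, sectorGibbsWeightTT' β t t' U n L i *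
        (expect X ((fockTranslate v).val *ᵥ sectorGibbsVectorTT' t t' U n L i)).re := by
    intro X
    rw [Complex.re_sum]
    simp_rw [hcast, ← mul_assoc, ← Complex.ofReal_mul, Complex.re_ofReal_mul, Complex.re_sum,
      Finset.mul_sum]
    rw [Finset.sum_comm]
    exact Finset.sum_congr rfl fun v _ => Finset.sum_congr rfl fun i _ => by ring
  calc (0 : ℝ) ≤ (Fintype.card (TorusSite 2 L) : ℝ)⁻¹ * ∑ v : TorusSite 2 L, ∑ k ∈ Finset.range (K + 1),
      (cp k * ∑ i, sectorGibbsWeightTT' β t t' U n L i *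
          (expect (Bᴴ * adPow (hubbardTorusTT' L t t' U) k B)
            ((fockTranslate v).val *ᵥ sectorGibbsVectorTT' t t' U n L i)).re +
        cq k * ∑ i, sectorGibbsWeightTT' β t t' U n L i *
          (expect (adPow (hubbardTorusTT' L t t' U) k B * Bᴴ)
            ((fockTranslate v).val *ᵥ sectorGibbsVectorTT' t t' U n L i)).re) :=
      mul_nonneg (inv_nonneg.2 (Nat.cast_nonneg _)) (Finset.sum_nonneg fun v _ => hv v)
    _ = _ := by
      rw [Finset.sum_comm, Finset.mul_sum]
      refine Finset.sum_congr rfl fun k hk => ?_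
      simp_rw [torusAvgExpectAt_of_injOn L h₁]
      rw [hΓ1 k hk, hΓ2 k hk, hre, hre, Finset.sum_add_distrib, ← Finset.mul_sum, ← Finset.mul_sum]
      ring

end TorusAverage

/-! ### §3 The KMS-moment rows of thermal torus-limit states -/

namespace InfVolFermionState

/-- **KMS-moment rows of thermal torus limits.** Let `ω` be a torus limit of the canonical Gibbs states
of `hubbardTorusTT' (Ls j) t t' U` at (any real) inverse temperature `β` on the sectors
`(rectN n (Ls j), S^z = 0)` along `Ls → ∞`. Then for every region `Λ`, every window `Λ' ⊇ Λ` containing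
the `K`-th king-move neighbourhood of `Λ` (`(fun S => thicken S 1)^[K] Λ ⊆ Λ'`), every local `A ∈ 𝔄_Λ`
conserving the local particle number and `S^z` (`Ã = Γ_{Λ⊆Λ'}A`, `H = H^{tt'}_{Λ'}`), and all
`p q : ℕ → ℝ` with `Σ_{k≤K}(pₖ + qₖe^{-βx})x^k ≥ 0` on `ℝ`:
`0 ≤ Σ_{k≤K} ( pₖ Re ω_{Λ'}(Ãᴴ ad_H^k Ã) + qₖ Re ω_{Λ'}((ad_H^k Ã)Ãᴴ) )`
— positivity of the exponential polynomial against the spectral measure of `Ã` in a `β`-KMS state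
(Itoi–Ishimori–Sato–Sakamoto §3), here for the gauge-invariant words of a canonical limit; the members
`K = 1`, `P` a tangent line of the EEB function, are the linearised energy–entropy-balance rows.
[cite: ItoiEtAl2023, §3] -/
theorem IsTorusLimitOfMixture.sum_range_kmsMoment_nonneg_of_sectorGibbs
    (t t' U : ℝ) {n β : ℝ} {ω : InfVolFermionState 2} {Ls : ℕ → ℕ}
    (h : ω.IsTorusLimitOfMixture (sectorGibbsCount n) (fun L => sectorGibbsWeightTT' β t t' U n L)
      (fun L => sectorGibbsVectorTT' t t' U n L) Ls)
    (hLs : Tendsto Ls atTop atTop) {Λ Λ' : Finset (Site 2)} (hΛ : Λ ⊆ Λ') {K : ℕ}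
    (hK : (fun S => thicken S 1)^[K] Λ ⊆ Λ') {A : FermionOp Λ}
    (hAN : Commute A totalNumber) (hAS : Commute A HubbardWave0.spinZ) (cp cq : ℕ → ℝ)
    (hP : ∀ x : ℝ, 0 ≤ ∑ k ∈ Finset.range (K + 1), (cp k + cq k * Real.exp (-(β * x))) * x ^ k) :
    0 ≤ ∑ k ∈ Finset.range (K + 1),
      (cp k * (ω.expect Λ'
          ((fermionEmbed (PolySite.incl hΛ) A)ᴴ *
            adPow ((hubbardTTPrimeFermionInteraction t t' U).localHamiltonian Λ') k
              (fermionEmbed (PolySite.incl hΛ) A))).re +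
        cq k * (ω.expect Λ'
          (adPow ((hubbardTTPrimeFermionInteraction t t' U).localHamiltonian Λ') k
              (fermionEmbed (PolySite.incl hΛ) A) * (fermionEmbed (PolySite.incl hΛ) A)ᴴ)).re) := by
  have hlim : Tendsto (fun j => ∑ k ∈ Finset.range (K + 1),
      (cp k * (∑ i, (sectorGibbsWeightTT' β t t' U n (Ls j) i : ℂ) *
          torusAvgExpect (Ls j) Λ'
            ((fermionEmbed (PolySite.incl hΛ) A)ᴴ *
              adPow ((hubbardTTPrimeFermionInteraction t t' U).localHamiltonian Λ') k
                (fermionEmbed (PolySite.incl hΛ) A))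
            (sectorGibbsVectorTT' t t' U n (Ls j) i)).re +
        cq k * (∑ i, (sectorGibbsWeightTT' β t t' U n (Ls j) i : ℂ) *
          torusAvgExpect (Ls j) Λ'
            (adPow ((hubbardTTPrimeFermionInteraction t t' U).localHamiltonian Λ') k
                (fermionEmbed (PolySite.incl hΛ) A) * (fermionEmbed (PolySite.incl hΛ) A)ᴴ)
            (sectorGibbsVectorTT' t t' U n (Ls j) i)).re)) atTop
      (𝓝 (∑ k ∈ Finset.range (K + 1),
        (cp k * (ω.expect Λ'
            ((fermionEmbed (PolySite.incl hΛ) A)ᴴ *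
              adPow ((hubbardTTPrimeFermionInteraction t t' U).localHamiltonian Λ') k
                (fermionEmbed (PolySite.incl hΛ) A))).re +
          cq k * (ω.expect Λ'
            (adPow ((hubbardTTPrimeFermionInteraction t t' U).localHamiltonian Λ') k
                (fermionEmbed (PolySite.incl hΛ) A) * (fermionEmbed (PolySite.incl hΛ) A)ᴴ)).re))) :=
    tendsto_finsetSum _ fun k _ =>
      (((Complex.continuous_re.tendsto _).comp (h Λ' _)).const_mul (cp k)).add
        (((Complex.continuous_re.tendsto _).comp (h Λ' _)).const_mul (cq k))
  refine ge_of_tendsto hlim ?_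
  filter_upwards [eventually_injOn_proj_of_tendsto (thicken Λ' 1) hLs, hLs.eventually_ge_atTop 1]
    with j hInj hj
  haveI : NeZero (Ls j) := ⟨by omega⟩
  simp_rw [torusAvgExpect_eq]
  exact re_sum_range_kmsMoment_torusAvgExpectAt_nonneg (Ls j) t t' U n β hΛ hK hInj hAN hAS cp cq hP

end InfVolFermionState

end Literature.MathematicalPhysics.QuantumLattice

end
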